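import Mathlib
import Literature.Geometry.Symplectic.JPlanePencilLocalFamily
import HarnessLib

/-!
# Route `SullivanDual`, crux `HyperbolicEnd` (stmt-SmoothPoincare4-7825), line `taubes-circle-pencil`:
# vocabulary — Taubes' untwisted near-symplectic model and the line's hypothesis packages

Route-posited objects (D-0016 `<Route>Defs` file) used by the registered stubs of the checked skeleton
`Cruxes/HyperbolicEnd/Lines/taubes_circle_pencil.lean` (lead reshape r1, 2026-08-17) and by the
`Theorems/` files that prove them.  Everything here is an explicit real-valued FORMULA on `ℝ⁴`, a
`Prop`-valued PREDICATE with explicit parameters over existing tree declarations, or a PROVED lemma;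
nothing is asserted and no closed proposition is defined.  Why: the planner's skeleton `let`-bound the
model terms inside every signature (the stub registry truncates a signature at its first `:=`) and
spelled the three hypothesis packages as raw 10–25-clause conjunctions four times over (past the
signature cap); here they are named once, with the SAME clauses in the same order.

**Taubes' model** (Taubes, Geom. Topol. 2 (1998), §1; Honda, Crelle 577 (2004)): on `S¹ × B³` with
coordinates `(t, a, b, c)` and the metric `g_tor` making `(dt, da, db, dc)` orthonormal,
`Q = ½(a² + b² − 2c²)`, `ωT = dt ∧ dQ + ⋆₃ dQ = a A₁ + b A₂ − 2c A₃` (`A₁ = dt∧da + db∧dc`,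
`A₂ = dt∧db + dc∧da`, `A₃ = dt∧dc + da∧db`; closed, self-dual, zero set the core circle, `∇ωT` of
rank 3: the UNTWISTED zero-circle model) and Taubes' SINGULAR almost complex structure
`J♭ = (a J₁ + b J₂ − 2c J₃)/|∇Q|`, `|∇Q| = √(a² + b² + 4c²)`, `g_tor(J_k ·, ·) = A_k` (`J♭² = −1`,
`ωT(u, J♭v) = |∇Q| g_tor(u, v)`, `J♭ ∂_t = ∇Q/|∇Q|`, `ker dt ∩ ker dQ` is `J♭`-complex; discontinuous
at the core), written in the flat coordinates `y ∈ ℝ⁴` of the solid torus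
`U δ = {(√(y₀²+y₁²) − 1)² + y₂² + y₃² < δ²}` about `C = {y₀² + y₁² = 1, y₂ = y₃ = 0}` via
`t = arg(y₀ + iy₁)`, `a = √(y₀²+y₁²) − 1`, `b = y₂`, `c = y₃` (frame `∂_t = (−y₁, y₀, 0, 0)`,
`∂_a = (y₀, y₁, 0, 0)/r`, `∂_b = e₂`, `∂_c = e₃`): `taubesR`, `taubesDt`, `taubesDa`, `taubesDQ`,
`taubesGrad`, `taubesForm` (= `ωT`), `taubesJ` (= `J♭`), `taubesTube` (= `U`), `taubesCore` (= `C`) —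
the planner's `let`-bound terms character for character, inner `let`s named.

**Hypothesis packages** (structures in `Prop`, one field per clause of the planner's skeleton): flat
side (`ℝ⁴`, model stub SM) `IsFlatTaubesTube`, `IsFlatNearSymplecticData`, `IsFlatPinnedStructure`,
`IsFlatTransparentFoliation`; manifold side (`M ∖ p`, used at homotopy 4-spheres) `IsTaubesTube`,
`IsNearSymplecticData` (S1's conclusion, S3's data), `IsPinnedStructure` (`J² = −1` and smooth off `Z`,
standard on the punctured `ε`-ball — the crux's clause verbatim —, tame at EVERY point off `Z`,
`= Ψᵢ_* J♭` in the punctured tubes), `IsTransparentFoliation` (leaf map smooth submersive with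
`J`-invariant kernel off `Z`, `C¹`-asymptotic and eventually equal to the pencil coordinate `w`, every
leaf off `Z` a finite union of injective `J`-holomorphic punctured planes).

**Proved**: unfolding lemmas and the registered non-vacuity helper `helper_taubesCore_subset_tube`.
Non-vacuity of the data packages is exactly the content of the existence stubs S1 / SM and is not
claimed here; the model identities (`J♭² = −1`, compatibility, tameness, horizontality) are registered
`helper_…` statements proved in sibling files.  Junk values: `taubesR y = 0` on the axis `y₀ = y₁ = 0`
(`x / 0 = 0`), `taubesGrad y = 0` exactly on `{a = b = c = 0}`; both loci miss
`taubesTube δ ∖ taubesCore` for `0 < δ < 1`, the only place the skeleton evaluates `taubesJ`.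

References: C. H. Taubes, Geom. Topol. 2 (1998) 221–332, §1; K. Honda, J. reine angew. Math. 577
(2004) 105–116; C. Gerig, Algebr. Geom. Topol. 21 (2021) 2543–2569, Thm 1.6; M. Gromov, Invent. Math.
82 (1985), 2.4.A′ (the pencil coordinate of the flat end).
-/

-- the registered namespace `Summit.SmoothPoincare4.SmoothPoincare4.…` repeats a component (P = Sub)
set_option linter.dupNamespace false

noncomputable section

open Set
open scoped Manifold ContDiff Topology
open Literature.Geometry.Kaehler Literature.Geometry.Symplectic

namespace Summit.SmoothPoincare4.SmoothPoincare4.Cruxes.HyperbolicEnd.TaubesCirclePencil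

local notation "E4" => EuclideanSpace ℝ (Fin 4)

/-! ## Taubes' model in flat coordinates -/

/-- `taubesR y = √(y₀² + y₁²)`, the distance from the axis `{y₀ = y₁ = 0}`; the toroidal coordinate
`a` is `taubesR y − 1`. (Taubes 1998, §1, toroidal coordinates about the core circle.) [folklore] -/
def taubesR (y : E4) : ℝ :=
  Real.sqrt (y 0 ^ 2 + y 1 ^ 2)

/-- `taubesDt y u = dt(u) = (y₀ u₁ − y₁ u₀) / r²`, the `∂_t`-component of the flat vector `u` at `y`
(`∂_t = (−y₁, y₀, 0, 0)`); junk value `0` on the axis. (Taubes 1998, §1.) [folklore] -/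
def taubesDt (y u : E4) : ℝ :=
  (y 0 * u 1 - y 1 * u 0) / taubesR y ^ 2

/-- `taubesDa y u = da(u) = dr(u) = (y₀ u₀ + y₁ u₁) / r`, the `∂_a`-component of `u` at `y`
(`∂_a = (y₀, y₁, 0, 0)/r`); junk value `0` on the axis. (Taubes 1998, §1.) [folklore] -/
def taubesDa (y u : E4) : ℝ :=
  (y 0 * u 0 + y 1 * u 1) / taubesR y

/-- `taubesDQ y u = dQ(u) = a da(u) + b u₂ − 2c u₃` for Taubes' Morse–Bott function
`Q = ½(a² + b² − 2c²)`, `a = r − 1`, `b = y₂`, `c = y₃`. (Taubes 1998, §1.) [folklore] -/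
def taubesDQ (y u : E4) : ℝ :=
  (taubesR y - 1) * taubesDa y u + y 2 * u 2 - 2 * y 3 * u 3

/-- `taubesGrad y = |∇Q|_{g_tor} = √(a² + b² + 4c²)` (`|ωT|_{g_tor} = √2 |∇Q|`); it vanishes exactly on
`{a = b = c = 0}`, i.e. on the core circle inside a tube of radius `< 1`. (Taubes 1998, §1.)
[folklore] -/
def taubesGrad (y : E4) : ℝ :=
  Real.sqrt ((taubesR y - 1) ^ 2 + y 2 ^ 2 + 4 * y 3 ^ 2)

/-- **Taubes' untwisted model form** `ωT = dt ∧ dQ + ⋆₃ dQ = a A₁ + b A₂ − 2c A₃` on two flat vectors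
`u, v` at `y`: `(dt∧dQ)(u,v) + a (db∧dc)(u,v) + b (dc∧da)(u,v) − 2c (da∧db)(u,v)`; closed, self-dual for
`g_tor`, `ωT ∧ ωT = 2(a² + b² + 4c²) dt∧da∧db∧dc = −(2/r)(a² + b² + 4c²) dy₀₁₂₃` (the toroidal frame is
negatively oriented in `ℝ⁴` — immaterial, tubes are free immersions). (Taubes 1998, §1.) [folklore] -/
def taubesForm (y u v : E4) : ℝ :=
  taubesDt y u * taubesDQ y v - taubesDt y v * taubesDQ y u
    + (taubesR y - 1) * (u 2 * v 3 - v 2 * u 3)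
    + y 2 * (u 3 * taubesDa y v - v 3 * taubesDa y u)
    - 2 * y 3 * (taubesDa y u * v 2 - taubesDa y v * u 2)

/-- **Taubes' singular almost complex structure** `J♭ = (a J₁ + b J₂ − 2c J₃)/|∇Q|` applied to a flat
vector `u` at `y`, in flat components: with `ut = taubesDt y u`, `ua = taubesDa y u`, `m = |∇Q|`, the
`(∂_t, ∂_a, ∂_b, ∂_c)`-components of `J♭ u` are `E₀ = (−a ua − b u₂ + 2c u₃)/m`,
`E₁ = (a ut + b u₃ + 2c u₂)/m`, `E₂ = (−a u₃ + b ut − 2c ua)/m`, `E₃ = (a u₂ − b ua − 2c ut)/m`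
(`J₁ : ∂_t ↦ ∂_a, ∂_b ↦ ∂_c`, `J₂ : ∂_t ↦ ∂_b, ∂_c ↦ ∂_a`, `J₃ : ∂_t ↦ ∂_c, ∂_a ↦ ∂_b`, `J₁J₂ = J₃`),
and the value is `E₀ ∂_t + E₁ ∂_a + E₂ e₂ + E₃ e₃`; junk `·/0 = 0` on the core and the axis.
(Taubes 1998, §1: the metric almost complex structure of `√2 ωT/|ωT|`.) [folklore] -/
def taubesJ (y u : E4) : E4 :=
  WithLp.toLp 2
    ![-(y 1) * ((-(taubesR y - 1) * taubesDa y u - y 2 * u 2 + 2 * y 3 * u 3) / taubesGrad y)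
        + y 0 / taubesR y * (((taubesR y - 1) * taubesDt y u + y 2 * u 3 + 2 * y 3 * u 2) / taubesGrad y),
      y 0 * ((-(taubesR y - 1) * taubesDa y u - y 2 * u 2 + 2 * y 3 * u 3) / taubesGrad y)
        + y 1 / taubesR y * (((taubesR y - 1) * taubesDt y u + y 2 * u 3 + 2 * y 3 * u 2) / taubesGrad y),
      (-(taubesR y - 1) * u 3 + y 2 * taubesDt y u - 2 * y 3 * taubesDa y u) / taubesGrad y,
      ((taubesR y - 1) * u 2 - y 2 * taubesDa y u - 2 * y 3 * taubesDt y u) / taubesGrad y]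

/-- **The flat Taubes tube** `U δ = {(√(y₀² + y₁²) − 1)² + y₂² + y₃² < δ²}`, the solid torus of
`g_tor`-radius `δ` about the core circle (Taubes 1998, §1: `S¹ × B³(δ)`). [folklore] -/
def taubesTube (δ : ℝ) : Set E4 :=
  {y | (taubesR y - 1) ^ 2 + y 2 ^ 2 + y 3 ^ 2 < δ ^ 2}

/-- **The core circle** `C = {y₀² + y₁² = 1, y₂ = y₃ = 0}`, the zero set of `ωT` in a tube. [folklore] -/
def taubesCore : Set E4 :=
  {y | y 0 ^ 2 + y 1 ^ 2 = 1 ∧ y 2 = 0 ∧ y 3 = 0}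

/-- Membership in the tube, unfolded. [folklore] -/
theorem mem_taubesTube {δ : ℝ} {y : E4} :
    y ∈ taubesTube δ ↔ (taubesR y - 1) ^ 2 + y 2 ^ 2 + y 3 ^ 2 < δ ^ 2 := Iff.rfl
/-- Membership in the core circle, unfolded. [folklore] -/
theorem mem_taubesCore {y : E4} : y ∈ taubesCore ↔ y 0 ^ 2 + y 1 ^ 2 = 1 ∧ y 2 = 0 ∧ y 3 = 0 :=
  Iff.rfl

/-! ## The flat packages (model stub SM, on `ℝ⁴`) -/

/-- **A flat Taubes tube of the 2-form `sf₀` on `ℝ⁴`, of radius `δ`, inside the ball `B_R`**: a map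
`Ψ : ℝ⁴ → ℝ⁴` which on the solid torus `taubesTube δ` is `C^∞`, injective and immersive, lands in
`{‖·‖ < R}`, and pulls `sf₀` back to Taubes' form: `sf₀ (Ψ y) (dΨ u, dΨ v) = ωT_y(u, v)`.  (So `sf₀`
vanishes transversally exactly along the untwisted circle `Ψ '' taubesCore` inside the tube image.)
Clauses verbatim from the planner's skeleton of line `taubes-circle-pencil`. [folklore] -/
@[folklore]
structure IsFlatTaubesTube (sf₀ : E4 → E4 [⋀^Fin 2]→L[ℝ] ℝ) (Ψ : E4 → E4) (δ R : ℝ) : Prop where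
  /-- `Ψ` is smooth on the tube. -/
  contDiffOn : ContDiffOn ℝ ∞ Ψ (taubesTube δ)
  /-- `Ψ` is injective on the tube. -/
  injOn : Set.InjOn Ψ (taubesTube δ)
  /-- `Ψ` is an immersion on the tube. -/
  injective_fderiv : ∀ y ∈ taubesTube δ, Function.Injective (fderiv ℝ Ψ y)
  /-- The tube image lies in the open ball of radius `R`. -/
  norm_lt : ∀ y ∈ taubesTube δ, ‖Ψ y‖ < R
  /-- `Ψ* sf₀ = ωT` on the tube. -/
  pullback_eq : ∀ y ∈ taubesTube δ, ∀ u v : E4,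
    sf₀ (Ψ y) ![fderiv ℝ Ψ y u, fderiv ℝ Ψ y v] = taubesForm y u v

/-- **Flat near-symplectic data on `ℝ⁴` with two Taubes tubes** (the data half of the model stub SM;
the Luttinger–Simpson birth model made standard at infinity): `0 < R`, `0 < δ < 1`, a `C^∞` closed
2-form `sf₀` equal to `ω₀ = stdSymplecticForm` on `{R ≤ ‖y‖}`, two flat Taubes tubes `Ψ₁, Ψ₂` of
`sf₀` inside `B_R` with disjoint images, and `sf₀` non-degenerate at every point off the two tube
images (so its zero set is the two untwisted circles `Ψᵢ '' taubesCore`).  Clauses verbatim from the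
planner's skeleton. [folklore] -/
@[folklore]
structure IsFlatNearSymplecticData (R δ : ℝ) (sf₀ : E4 → E4 [⋀^Fin 2]→L[ℝ] ℝ) (Ψ₁ Ψ₂ : E4 → E4) :
    Prop where
  /-- The standard region starts at a positive radius. -/
  R_pos : 0 < R
  /-- The tube radius is positive … -/
  δ_pos : 0 < δ
  /-- … and less than `1` (the tube misses the axis). -/
  δ_lt_one : δ < 1
  /-- `sf₀` is smooth. -/
  contDiff : ContDiff ℝ ∞ sf₀
  /-- `sf₀` is closed. -/
  extDeriv_eq_zero : extDeriv sf₀ = 0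
  /-- `sf₀ = ω₀` on `{R ≤ ‖y‖}`. -/
  eq_std : ∀ y : E4, R ≤ ‖y‖ → ∀ a b : E4, sf₀ y ![a, b] = stdSymplecticForm a b
  /-- The first Taubes tube. -/
  tube₁ : IsFlatTaubesTube sf₀ Ψ₁ δ R
  /-- The second Taubes tube. -/
  tube₂ : IsFlatTaubesTube sf₀ Ψ₂ δ R
  /-- The tube images are disjoint. -/
  disjoint : Disjoint (Ψ₁ '' taubesTube δ) (Ψ₂ '' taubesTube δ)
  /-- `sf₀` is non-degenerate off the tube images. -/
  nondegenerate : ∀ y : E4, y ∉ Ψ₁ '' taubesTube δ ∪ Ψ₂ '' taubesTube δ →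
    ∀ a : E4, a ≠ 0 → ∃ b : E4, sf₀ y ![a, b] ≠ 0

/-- **A flat pinned almost complex structure** for flat near-symplectic data (the `J` of the model
stub SM): off the zero set `Z₀ = Ψ₁ '' taubesCore ∪ Ψ₂ '' taubesCore`, `J² = −1` and `J` is `C^∞`; `J`
is the standard structure `i ⊕ i : a ↦ (−a₁, a₀, −a₃, a₂)` (the one with `⟪(i⊕i) a, b⟫ = ω₀(a, b)`) on
`{R ≤ ‖y‖}`; `J` is `sf₀`-TAME AT EVERY POINT OFF `Z₀`; and `J = Ψᵢ_* J♭` in each punctured tube: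
`J (Ψᵢ y) (dΨᵢ u) = dΨᵢ (J♭_y u)` for `y ∈ taubesTube δ ∖ taubesCore`.  Nothing is asked on `Z₀`
(twist lemma of the line card).  Clauses verbatim from the planner's skeleton. [folklore] -/
@[folklore]
structure IsFlatPinnedStructure (R δ : ℝ) (sf₀ : E4 → E4 [⋀^Fin 2]→L[ℝ] ℝ) (Ψ₁ Ψ₂ : E4 → E4)
    (J : E4 → E4 →L[ℝ] E4) : Prop where
  /-- `J² = −1` off `Z₀`. -/
  sq_eq : ∀ y : E4, y ∉ (Ψ₁ '' taubesCore ∪ Ψ₂ '' taubesCore) → ∀ a : E4, J y (J y a) = -a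
  /-- `J` is smooth off `Z₀`. -/
  contDiffAt : ∀ y : E4, y ∉ (Ψ₁ '' taubesCore ∪ Ψ₂ '' taubesCore) → ContDiffAt ℝ ∞ J y
  /-- `J = i ⊕ i` on `{R ≤ ‖y‖}`. -/
  eq_std : ∀ y : E4, R ≤ ‖y‖ → ∀ a : E4, J y a = WithLp.toLp 2 ![-(a 1), a 0, -(a 3), a 2]
  /-- `J` is `sf₀`-tame at every point off `Z₀`. -/
  tame : ∀ y : E4, y ∉ (Ψ₁ '' taubesCore ∪ Ψ₂ '' taubesCore) → ∀ a : E4, a ≠ 0 → 0 < sf₀ y ![a, J y a]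
  /-- `J = Ψ₁_* J♭` in the first punctured tube. -/
  pinned₁ : ∀ y ∈ taubesTube δ, y ∉ taubesCore → ∀ u : E4,
    J (Ψ₁ y) (fderiv ℝ Ψ₁ y u) = fderiv ℝ Ψ₁ y (taubesJ y u)
  /-- `J = Ψ₂_* J♭` in the second punctured tube. -/
  pinned₂ : ∀ y ∈ taubesTube δ, y ∉ taubesCore → ∀ u : E4,
    J (Ψ₂ y) (fderiv ℝ Ψ₂ y u) = fderiv ℝ Ψ₂ y (taubesJ y u)

/-- **A flat transparent planar `J`-foliation of `ℝ⁴ ∖ Z₀`** (the conclusion of the model stub SM),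
`Z₀ = Ψ₁ '' taubesCore ∪ Ψ₂ '' taubesCore`: a leaf map `π : ℝ⁴ → ℂ`, `C^∞` and submersive at every
point off `Z₀`, with `J`-invariant kernel off `Z₀` (the leaves are `J`-complex), `C¹`-asymptotic to
the pencil coordinate `w = y₂ + i y₃` at infinity and EQUAL to `w` on `{R' ≤ |w|}` (far leaves are the
flat lines), and with every leaf `π⁻¹(t) ∖ Z₀` a finite union of images of injective `J`-holomorphic
maps `ℂ ∖ (finite set) → ℝ⁴ ∖ Z₀` (genus `0`, finite type).  Nothing is asked on `Z₀`.  Clauses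
verbatim from the planner's skeleton. [folklore] -/
@[folklore]
structure IsFlatTransparentFoliation (Ψ₁ Ψ₂ : E4 → E4) (J : E4 → E4 →L[ℝ] E4) (π : E4 → ℂ) :
    Prop where
  /-- `π` is smooth off `Z₀`. -/
  contDiffAt : ∀ y : E4, y ∉ (Ψ₁ '' taubesCore ∪ Ψ₂ '' taubesCore) → ContDiffAt ℝ ∞ π y
  /-- `π` is submersive off `Z₀`. -/
  surjective : ∀ y : E4, y ∉ (Ψ₁ '' taubesCore ∪ Ψ₂ '' taubesCore) → Function.Surjective (fderiv ℝ π y)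
  /-- `ker dπ` is `J`-invariant off `Z₀`. -/
  invariant : ∀ y : E4, y ∉ (Ψ₁ '' taubesCore ∪ Ψ₂ '' taubesCore) →
    ∀ a : E4, fderiv ℝ π y a = 0 → fderiv ℝ π y (J y a) = 0
  /-- `π` is `C¹`-asymptotic to `w = y₂ + i y₃` at infinity. -/
  asymptotic : ∀ η : ℝ, 0 < η → ∃ ρ : ℝ, ∀ y : E4, ρ ≤ ‖y‖ →
    ‖π y - (⟨y 2, y 3⟩ : ℂ)‖ ≤ η ∧ ∀ a : E4, ‖fderiv ℝ π y a - (⟨a 2, a 3⟩ : ℂ)‖ ≤ η * ‖a‖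
  /-- `π = w` where `|w|` is large. -/
  eventually_eq : ∃ R' : ℝ, ∀ y : E4, R' ≤ ‖(⟨y 2, y 3⟩ : ℂ)‖ → π y = (⟨y 2, y 3⟩ : ℂ)
  /-- Every leaf off `Z₀` is a finite union of injective `J`-holomorphic punctured planes. -/
  leaves : ∀ t : ℂ, ∃ (n : ℕ) (u : Fin n → ℂ → E4) (A : Fin n → Finset ℂ),
    (∀ i, ContDiffOn ℝ ∞ (u i) (↑(A i) : Set ℂ)ᶜ) ∧
    (∀ i, ∀ z : ℂ, z ∉ A i → ∀ ζ : ℂ, fderiv ℝ (u i) z (Complex.I * ζ) = J (u i z) (fderiv ℝ (u i) z ζ)) ∧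
    (∀ i, Set.InjOn (u i) (↑(A i) : Set ℂ)ᶜ) ∧
    (∀ i, ∀ z : ℂ, z ∉ A i → u i z ∉ (Ψ₁ '' taubesCore ∪ Ψ₂ '' taubesCore)) ∧
    π ⁻¹' {t} ∩ (Ψ₁ '' taubesCore ∪ Ψ₂ '' taubesCore)ᶜ = ⋃ i, u i '' (↑(A i) : Set ℂ)ᶜ

/-! ## The manifold packages (`M ∖ p`; used at punctured homotopy 4-spheres) -/

section Manifold

variable {M : Type*} [TopologicalSpace M] [ChartedSpace E4 M] [IsManifold (𝓡 4) ∞ M] [T1Space M]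

/-- **A Taubes tube of the 2-form `sf` on `M ∖ p`, of radius `δ`, off the punctured `ε`-chart-ball**:
`Ψ : ℝ⁴ → M ∖ p`, on `taubesTube δ` smooth, injective and immersive, avoiding the punctured
`ε`-chart-ball about `p`, with `Ψ* sf = ωT` there:
`sf (Ψ y) (dΨ u, dΨ v) = taubesForm y u v`.  Clauses verbatim from the planner's skeleton. [folklore] -/
@[folklore]
structure IsTaubesTube (p : M) (ε δ : ℝ) (sf : MForm (𝓡 4) (punctured p) ℝ 2)
    (Ψ : E4 → punctured p) : Prop where
  /-- `Ψ` is smooth on the tube. -/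
  contMDiffOn : ContMDiffOn 𝓘(ℝ, E4) (𝓡 4) ∞ Ψ (taubesTube δ)
  /-- `Ψ` is injective on the tube. -/
  injOn : Set.InjOn Ψ (taubesTube δ)
  /-- `Ψ` is an immersion on the tube. -/
  injective_mfderiv : ∀ y ∈ taubesTube δ, Function.Injective (mfderiv 𝓘(ℝ, E4) (𝓡 4) Ψ y)
  /-- The tube avoids the punctured `ε`-chart-ball about `p`. -/
  not_inPuncturedChartBall : ∀ y ∈ taubesTube δ, ¬ InPuncturedChartBall p ε (Ψ y)
  /-- `Ψ* sf = ωT` on the tube. -/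
  pullback_eq : ∀ y ∈ taubesTube δ, ∀ u v : E4,
    sf (Ψ y) ![mfderiv 𝓘(ℝ, E4) (𝓡 4) Ψ y u, mfderiv 𝓘(ℝ, E4) (𝓡 4) Ψ y v] = taubesForm y u v

/-- **Relative near-symplectic data with two Taubes tubes on `M ∖ p`** (the conclusion of stub S1 and
the data of stubs S3/S4): `0 < ε` with `closedBall (e p) ε` inside the chart target, `0 < δ < 1`, a
smooth closed 2-form `sf` on `M ∖ p` equal to the inverted-chart model `ι*ω₀` on the punctured
`ε`-chart-ball (the clause of `RelativeSullivanDuality` / `IsSymplecticStandardNearPoint` verbatim), two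
Taubes tubes `Ψ₁, Ψ₂` of `sf` with disjoint images, and `sf` non-degenerate at every point off the tube
images (so `sf` vanishes exactly, and transversally, on the two untwisted circles `Ψᵢ '' taubesCore`).
Clauses verbatim from the planner's skeleton (Gerig 2021 Thm 1.6 + Honda 2004 + Perutz 2006 in
print). [folklore] -/
@[folklore]
structure IsNearSymplecticData (p : M) (ε δ : ℝ) (sf : MForm (𝓡 4) (punctured p) ℝ 2)
    (Ψ₁ Ψ₂ : E4 → punctured p) : Prop where
  /-- The chart-ball radius is positive. -/
  ε_pos : 0 < ε
  /-- The closed `ε`-ball about `e p` lies in the chart target. -/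
  closedBall_subset : Metric.closedBall (extChartAt (𝓡 4) p p) ε ⊆ (extChartAt (𝓡 4) p).target
  /-- The tube radius is positive … -/
  δ_pos : 0 < δ
  /-- … and less than `1`. -/
  δ_lt_one : δ < 1
  /-- `sf` is smooth. -/
  smooth : IsSmoothForm sf
  /-- `sf` is closed. -/
  closed : IsClosedForm sf
  /-- `sf = ι*ω₀` in the chart on the punctured `ε`-ball. -/
  eq_inverted : ∀ x : punctured p, InPuncturedChartBall p ε x → ∀ v w : TangentSpace (𝓡 4) x,
    sf x ![v, w] = invertedStdForm (extChartAt (𝓡 4) p x.1 - extChartAt (𝓡 4) p p)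
      (mfderiv (𝓡 4) 𝓘(ℝ, E4) (fun z : punctured p => extChartAt (𝓡 4) p z.1) x v)
      (mfderiv (𝓡 4) 𝓘(ℝ, E4) (fun z : punctured p => extChartAt (𝓡 4) p z.1) x w)
  /-- The first Taubes tube. -/
  tube₁ : IsTaubesTube p ε δ sf Ψ₁
  /-- The second Taubes tube. -/
  tube₂ : IsTaubesTube p ε δ sf Ψ₂
  /-- The tube images are disjoint. -/
  disjoint : Disjoint (Ψ₁ '' taubesTube δ) (Ψ₂ '' taubesTube δ)
  /-- `sf` is non-degenerate off the tube images. -/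
  nondegenerate : ∀ x : punctured p, x ∉ Ψ₁ '' taubesTube δ ∪ Ψ₂ '' taubesTube δ →
    ∀ v : TangentSpace (𝓡 4) x, v ≠ 0 → ∃ w : TangentSpace (𝓡 4) x, sf x ![v, w] ≠ 0

/-- **A pinned almost complex structure for near-symplectic data on `M ∖ p`** (the `J` of stubs
S3/S4), `Z = Ψ₁ '' taubesCore ∪ Ψ₂ '' taubesCore`: off `Z`, `J² = −1` and `J` is `C^∞` in tangent
coordinates; on the punctured `ε`-chart-ball `J` is STANDARD — the crux's clause verbatim,
`⟪dι(de(J v)), b⟫ = ω₀(dι(de v), b)`, i.e. `J = (ι ∘ (e − e p))^* (i ⊕ i)` —; `J` is `sf`-TAME AT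
EVERY POINT OFF `Z`; and `J = Ψᵢ_* J♭` (Taubes' singular structure) in each punctured tube.  Nothing is
asked on `Z` (twist lemma of the line card).  Clauses verbatim from the planner's skeleton. [folklore] -/
@[folklore]
structure IsPinnedStructure (p : M) (ε δ : ℝ) (sf : MForm (𝓡 4) (punctured p) ℝ 2)
    (Ψ₁ Ψ₂ : E4 → punctured p)
    (J : ∀ x : punctured p, TangentSpace (𝓡 4) x →L[ℝ] TangentSpace (𝓡 4) x) : Prop where
  /-- `J² = −1` off `Z`. -/
  sq_eq : ∀ x : punctured p, x ∉ (Ψ₁ '' taubesCore ∪ Ψ₂ '' taubesCore) →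
    ∀ v : TangentSpace (𝓡 4) x, J x (J x v) = -v
  /-- `J` is smooth in tangent coordinates off `Z`. -/
  contMDiffAt : ∀ x₀ : punctured p, x₀ ∉ (Ψ₁ '' taubesCore ∪ Ψ₂ '' taubesCore) →
    ContMDiffAt (𝓡 4) 𝓘(ℝ, E4 →L[ℝ] E4) ∞
      (inTangentCoordinates (𝓡 4) (𝓡 4) (id : punctured p → punctured p) id (fun x => J x) x₀) x₀
  /-- `J` is the standard structure of the inverted chart on the punctured `ε`-ball. -/
  eq_std : ∀ x : punctured p, InPuncturedChartBall p ε x →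
    ∀ (v : TangentSpace (𝓡 4) x) (b : E4),
      inner ℝ (fderiv ℝ inversion (extChartAt (𝓡 4) p x.1 - extChartAt (𝓡 4) p p)
        (mfderiv (𝓡 4) 𝓘(ℝ, E4) (fun z : punctured p => extChartAt (𝓡 4) p z.1) x (J x v))) b =
      stdSymplecticForm (fderiv ℝ inversion (extChartAt (𝓡 4) p x.1 - extChartAt (𝓡 4) p p)
        (mfderiv (𝓡 4) 𝓘(ℝ, E4) (fun z : punctured p => extChartAt (𝓡 4) p z.1) x v)) b
  /-- `J` is `sf`-tame at every point off `Z`. -/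
  tame : ∀ x : punctured p, x ∉ (Ψ₁ '' taubesCore ∪ Ψ₂ '' taubesCore) →
    ∀ v : TangentSpace (𝓡 4) x, v ≠ 0 → 0 < sf x ![v, J x v]
  /-- `J = Ψ₁_* J♭` in the first punctured tube. -/
  pinned₁ : ∀ y ∈ taubesTube δ, y ∉ taubesCore → ∀ u : E4,
    J (Ψ₁ y) (mfderiv 𝓘(ℝ, E4) (𝓡 4) Ψ₁ y u) = mfderiv 𝓘(ℝ, E4) (𝓡 4) Ψ₁ y (taubesJ y u)
  /-- `J = Ψ₂_* J♭` in the second punctured tube. -/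
  pinned₂ : ∀ y ∈ taubesTube δ, y ∉ taubesCore → ∀ u : E4,
    J (Ψ₂ y) (mfderiv 𝓘(ℝ, E4) (𝓡 4) Ψ₂ y u) = mfderiv 𝓘(ℝ, E4) (𝓡 4) Ψ₂ y (taubesJ y u)

/-- **A transparent planar `J`-foliation of `(M ∖ p) ∖ Z`** (the conclusion of stub S3, the hypothesis
of stub S4), `Z = Ψ₁ '' taubesCore ∪ Ψ₂ '' taubesCore`: a leaf map `π : M ∖ p → ℂ`, smooth and
submersive at every point off `Z`, with `J`-invariant kernel off `Z` (leaves are `J`-complex),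
`C¹`-ASYMPTOTIC to the pencil coordinate `w = (pencilCoord p ·).2` at `p` (for every `η > 0` some
punctured chart-ball `B_ρ` has `‖π − w‖ ≤ η` and `‖d(π − w) v‖ ≤ η ‖dy v‖`, `y = ι(e · − e p)`),
EQUAL to `w` where `R ≤ |w|` on the punctured `ε`-ball (far leaves are the flat lines), and with every
leaf `π⁻¹(t) ∖ Z` a finite union of images of injective `J`-holomorphic maps
`ℂ ∖ (finite set) → (M ∖ p) ∖ Z` (genus `0`, finite type).  Nothing is asked on `Z`.  Clauses verbatim
from the planner's skeleton. [folklore] -/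
@[folklore]
structure IsTransparentFoliation (p : M) (ε : ℝ) (Ψ₁ Ψ₂ : E4 → punctured p)
    (J : ∀ x : punctured p, TangentSpace (𝓡 4) x →L[ℝ] TangentSpace (𝓡 4) x)
    (π : punctured p → ℂ) : Prop where
  /-- `π` is smooth off `Z`. -/
  contMDiffAt : ∀ x : punctured p, x ∉ (Ψ₁ '' taubesCore ∪ Ψ₂ '' taubesCore) →
    ContMDiffAt (𝓡 4) 𝓘(ℝ, ℂ) ∞ π x
  /-- `π` is submersive off `Z`. -/
  surjective : ∀ x : punctured p, x ∉ (Ψ₁ '' taubesCore ∪ Ψ₂ '' taubesCore) →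
    Function.Surjective (mfderiv (𝓡 4) 𝓘(ℝ, ℂ) π x)
  /-- `ker dπ` is `J`-invariant off `Z`. -/
  invariant : ∀ x : punctured p, x ∉ (Ψ₁ '' taubesCore ∪ Ψ₂ '' taubesCore) →
    ∀ v : TangentSpace (𝓡 4) x,
      mfderiv (𝓡 4) 𝓘(ℝ, ℂ) π x v = 0 → mfderiv (𝓡 4) 𝓘(ℝ, ℂ) π x (J x v) = 0
  /-- `π` is `C¹`-asymptotic to the pencil coordinate `w` at the puncture. -/
  asymptotic : ∀ η : ℝ, 0 < η → ∃ ρ : ℝ, 0 < ρ ∧ ∀ x : punctured p, InPuncturedChartBall p ρ x →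
    ‖π x - (pencilCoord p x).2‖ ≤ η ∧
    ∀ v : TangentSpace (𝓡 4) x,
      ‖@id ℂ (mfderiv (𝓡 4) 𝓘(ℝ, ℂ) π x v) -
          @id ℂ (mfderiv (𝓡 4) 𝓘(ℝ, ℂ) (fun x' : punctured p => (pencilCoord p x').2) x v)‖ ≤
        η * ‖@id E4 (mfderiv (𝓡 4) 𝓘(ℝ, E4)
          (fun x' : punctured p => inversion (extChartAt (𝓡 4) p x'.1 - extChartAt (𝓡 4) p p)) x v)‖
  /-- `π = w` on the punctured `ε`-ball where `|w|` is large. -/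
  eventually_eq : ∃ R : ℝ, ∀ x : punctured p, InPuncturedChartBall p ε x →
    R ≤ ‖(pencilCoord p x).2‖ → π x = (pencilCoord p x).2
  /-- Every leaf off `Z` is a finite union of injective `J`-holomorphic punctured planes. -/
  leaves : ∀ t : ℂ, ∃ (n : ℕ) (u : Fin n → ℂ → punctured p) (A : Fin n → Finset ℂ),
    (∀ i, ContMDiffOn 𝓘(ℝ, ℂ) (𝓡 4) ∞ (u i) (↑(A i) : Set ℂ)ᶜ) ∧
    (∀ i, ∀ z : ℂ, z ∉ A i → ∀ ζ : ℂ,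
      mfderiv 𝓘(ℝ, ℂ) (𝓡 4) (u i) z (Complex.I * ζ : ℂ) =
        J (u i z) (mfderiv 𝓘(ℝ, ℂ) (𝓡 4) (u i) z (ζ : ℂ))) ∧
    (∀ i, Set.InjOn (u i) (↑(A i) : Set ℂ)ᶜ) ∧
    (∀ i, ∀ z : ℂ, z ∉ A i → u i z ∉ (Ψ₁ '' taubesCore ∪ Ψ₂ '' taubesCore)) ∧
    π ⁻¹' {t} ∩ (Ψ₁ '' taubesCore ∪ Ψ₂ '' taubesCore)ᶜ = ⋃ i, u i '' (↑(A i) : Set ℂ)ᶜ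

end Manifold

/-! ## Non-vacuity (registered helper of stmt-SmoothPoincare4-7825) -/

/-- **The core circle lies in every tube of positive radius**, so the skeleton's clauses quantified
over `y ∈ taubesTube δ, y ∉ taubesCore` remove a nonempty set and the pinning clause
`J (Ψ y) (dΨ u) = dΨ (J♭ u)` is asked exactly off the zero circle. [folklore] -/
theorem helper_taubesCore_subset_tube :
    ∀ δ : ℝ, 0 < δ → taubesCore ⊆ taubesTube δ := by
  intro δ hδ y hy
  rcases hy with ⟨h01, h2, h3⟩
  have hδ2 : (0 : ℝ) < δ ^ 2 := by positivity
  simpa [mem_taubesTube, taubesR, h01, h2, h3] using hδ2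

end Summit.SmoothPoincare4.SmoothPoincare4.Cruxes.HyperbolicEnd.TaubesCirclePencil

end
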